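import Summits.Ventures.HSemireg.WedgeHankelOuterImage
import Summits.Ventures.HSemireg.WedgeHankelPairMixingSiegel
import Summits.Ventures.HSemireg.WedgeHankelPairMixingProjection
import Summits.Ventures.HSemireg.WedgeHankelSiegelIdealMonomials

/-!
# Venture HSemireg — THE SIEGEL IDEAL OF A SUB-BOX AND THE EXCESS LAW ON EVERY SUB-BOX: for every set `T` of pairs `dim (SI_k ⊓ Sp(pairs ⊆ T)) = C(2|T|, k) − (k+1)·C(|T|, k)`
# (gen 11's dimension with `|T|` for `n`), so with K40 **`dim (Kr(univ, w_N q, k) ⊓ Sp(pairs ⊆ T)) − dim (SI_k ⊓ Sp(pairs ⊆ T)) = C(|T|, k) · (k + 1 − rank H_k(q))`** — the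
# excess law of the full box holds verbatim on every sub-box, every field, uniform in `n`

HONEST FRAMING. Part of the Lean index of the computation cell `pub-hsemireg` (seat p10 gen 23, Sunday typer «UNIFORM-IN-n»).
Finite-dimensional EXTERIOR ALGEBRA over a field ONLY: no variety, no cohomology theory, no sheaf, no Ext group, no semiregularity map;
nothing here says that HC / HC_CM / HC_AV holds; no Literature fact is declared or used.  Custodian versions as in `WedgeHankelSiegelIdeal` (1/3); the dictionary (`SI_k` = th-6's
«Θ-isotropic part»; `Sp(pairs ⊆ T)` = the forms of the sub-product of the pairs in `T`) is QUOTED, never asserted.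

WHAT IS IN THE TREE.  Gen 11: `siegelIdeal`, `sym`, `sym_eq_zero_of_mem_siegelIdeal`, the standard monomials `rep` / `repSpan`, `rep_eq_smul_B`, `rep_mem_exteriorPower`, `linearIndependent_sym_rep`,
`B_mem_repSpan_sup`; J-leaves `Pm_mem_siegelIdeal` (`SI_k` is stable under EVERY `Pm M`) and `Pm_diagonal_indicator_apply` (`Pm(1_T) = proj_{pairs ⊆ T}`); K39 `finrank_Hom_In`; K40
`finrank_Kr_w_inf_Sp_pairs_add`; L1 (this seat) `Hom_univ_inf_Sp_pairs_eq`, `card_letters_eq`.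
THIS FILE (namespace `Summit.Ventures.HSemireg.Wedge.HankelOuter` continued; imports L1 and the two J-leaves):
* §395 `proj_pairs_mem_siegelIdeal` (`SI_k` is closed under `proj_{pairs ⊆ T}`, every `k`), `pairs_supp_rep_iff` (the letters of `r_{S,i}` lie in the pairs of `T` iff `S ⊆ T`),
  `proj_pairs_rep`, `proj_pairs_mem_span_rep_sub`, `span_rep_sub_le`, `Hom_inf_Sp_pairs_le_span_rep_sup`, `linearIndependent_rep_sub`, `span_rep_sub_inf_siegelIdeal_eq_bot`,
  `card_powersetCard_mul`, and **`finrank_siegelIdeal_inf_Sp_pairs_add`: `dim (SI_k ⊓ Sp(pairs ⊆ T)) + (k+1)·C(|T|,k) = C(|T|+|T|, k)`** for EVERY `T`, `k`, field.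
* §396 **THE EXCESS LAW ON EVERY SUB-BOX: `finrank_Kr_w_inf_Sp_pairs_eq_siegelIdeal_add`:
  `dim (Kr(univ, w_N q, k) ⊓ Sp(pairs ⊆ T)) + C(|T|,k)·rank H_k(q) = dim (SI_k ⊓ Sp(pairs ⊆ T)) + (k+1)·C(|T|,k)`**, `siegelIdeal_inf_Sp_pairs_le_Kr`, and
  **`Kr_w_inf_Sp_pairs_eq_siegelIdeal_inf_iff`**: the two coincide iff `|T| < k` or `rank H_k(q) = k + 1`.
READING: gen 11's `dim SI_k = C(2n,k) − (k+1)·C(n,k)` and its excess law are statements about the sub-box of ANY `M` pairs with `M` for `n`: the restricted Siegel ideal is the Siegel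
ideal of the sub-box.  Nothing Ext-side.  New names only.
-/

open Module

namespace Summit.Ventures.HSemireg.Wedge.HankelOuter

open Summit.Ventures.HSemireg.Wedge Summit.Ventures.HSemireg.Wedge.Kunneth Summit.Ventures.HSemireg.Wedge.Hankel
  Summit.Ventures.HSemireg.Wedge.BasisFree Summit.Ventures.HSemireg.Wedge.HankelSiegel Summit.Ventures.HSemireg.Wedge.HankelSiegelIdeal
  Summit.Ventures.HSemireg.Wedge.KunnethKernel Summit.Ventures.HSemireg.Wedge.HankelFrameChange Summit.Ventures.HSemireg.Wedge.Weil
  Summit.Ventures.HSemireg.Wedge.HankelPairMixing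

variable (K : Type*) [Field K] {N : ℕ}

/-! ## §395. The Siegel ideal of a sub-box -/

/-- **`SI_k` is closed under the projection onto the forms of the pairs of `T`** (`Pm(1_T) = proj_{pairs ⊆ T}` and `SI_k` is stable under every `Pm`; every `k`). -/
theorem proj_pairs_mem_siegelIdeal (T : Finset (Fin N)) {k : ℕ} {θ : HT K (In N)} (hθ : θ ∈ siegelIdeal K N k) :
    proj (K := K) (fun s : Finset (In N) => ∀ i ∈ s, pr i ∈ T) θ ∈ siegelIdeal K N k := by
  rw [← Pm_diagonal_indicator_apply]
  exact Pm_mem_siegelIdeal K _ hθ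

omit [Field K] in
/-- the letters of the standard monomial `r_{S,i}` lie in the pairs of `T` iff `S ⊆ T`. -/
theorem pairs_supp_rep_iff (T : Finset (Fin N)) {k : ℕ} (p : RIdx N k) :
    (∀ i ∈ xs (p.1.1 \ canon p.1.1 p.2) ∪ ys (canon p.1.1 p.2), pr i ∈ T) ↔ p.1.1 ⊆ T := by
  have hsub := canon_subset p.1.1 p.2
  constructor
  · intro h a ha
    by_cases haA : a ∈ canon p.1.1 p.2
    · have h1 := h (Fin.natAdd N a) (Finset.mem_union_right _ (natAdd_mem_ys.mpr haA))
      rwa [show Fin.natAdd N a = yJ N a from rfl, pr_yJ] at h1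
    · have h1 := h (Fin.castAdd N a) (Finset.mem_union_left _ (castAdd_mem_xs.mpr (Finset.mem_sdiff.mpr ⟨ha, haA⟩)))
      rwa [show Fin.castAdd N a = xJ N a from rfl, pr_xJ] at h1
  · intro h i hi
    rcases Finset.mem_union.mp hi with hi | hi
    · obtain ⟨a, ha, rfl⟩ := Finset.mem_map.mp hi
      rw [show Fin.castAddEmb N a = xJ N a from rfl, pr_xJ]
      exact h (Finset.mem_sdiff.mp ha).1
    · obtain ⟨a, ha, rfl⟩ := Finset.mem_map.mp hi
      rw [show Fin.natAddEmb N a = yJ N a from rfl, pr_yJ]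
      exact h (hsub ha)

/-- the projection of a standard monomial onto the pairs of `T`: itself if `S ⊆ T`, else `0`. -/
theorem proj_pairs_rep (T : Finset (Fin N)) {k : ℕ} (p : RIdx N k) :
    proj (K := K) (fun s : Finset (In N) => ∀ i ∈ s, pr i ∈ T) (rep K p) = if p.1.1 ⊆ T then rep K p else 0 := by
  obtain ⟨c, -, hc⟩ := rep_eq_smul_B K p
  rw [hc, map_smul, proj_B]
  by_cases h : p.1.1 ⊆ T
  · rw [if_pos ((pairs_supp_rep_iff T p).mpr h), if_pos h]
  · rw [if_neg (fun h' => h ((pairs_supp_rep_iff T p).mp h')), if_neg h, smul_zero]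

/-- **the projection of `repSpan` onto the pairs of `T` is the span of the sub-box's standard monomials.** -/
theorem proj_pairs_mem_span_rep_sub (T : Finset (Fin N)) {k : ℕ} {r : HT K (In N)} (hr : r ∈ repSpan K N k) :
    proj (K := K) (fun s : Finset (In N) => ∀ i ∈ s, pr i ∈ T) r
      ∈ Submodule.span K (Set.range fun x : ↥(T.powersetCard k) × Fin (k + 1) => rep K ((⟨⟨(x.1 : Finset (Fin N)), (Finset.mem_powersetCard.mp x.1.2).2⟩, x.2⟩ : RIdx N k))) := by
  induction hr using Submodule.span_induction with
  | mem x hx =>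
    obtain ⟨p, rfl⟩ := hx
    rw [proj_pairs_rep]
    split_ifs with hpT
    · obtain ⟨⟨S, hS⟩, i⟩ := p
      exact Submodule.subset_span ⟨(⟨S, Finset.mem_powersetCard.mpr ⟨hpT, hS⟩⟩, i), rfl⟩
    · exact Submodule.zero_mem _
  | zero => rw [map_zero]; exact Submodule.zero_mem _
  | add x y _ _ hx hy => rw [map_add]; exact Submodule.add_mem _ hx hy
  | smul a x _ hx => rw [map_smul]; exact Submodule.smul_mem _ _ hx

/-- the sub-box's standard monomials are `k`-forms on the pairs of `T`. -/
theorem span_rep_sub_le (T : Finset (Fin N)) (k : ℕ) :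
    Submodule.span K (Set.range fun x : ↥(T.powersetCard k) × Fin (k + 1) => rep K ((⟨⟨(x.1 : Finset (Fin N)), (Finset.mem_powersetCard.mp x.1.2).2⟩, x.2⟩ : RIdx N k)))
      ≤ Hom K (In N) (Finset.univ : Finset (In N)) k ⊓ Sp K (fun s : Finset (In N) => ∀ i ∈ s, pr i ∈ T) := by
  rw [Submodule.span_le]
  rintro _ ⟨x, rfl⟩
  refine ⟨?_, ?_⟩
  · rw [← exteriorPower_eq_Hom_univ]
    exact rep_mem_exteriorPower K _
  · obtain ⟨c, -, hc⟩ := rep_eq_smul_B K ((⟨⟨(x.1 : Finset (Fin N)), (Finset.mem_powersetCard.mp x.1.2).2⟩, x.2⟩ : RIdx N k))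
    show rep K _ ∈ _
    rw [hc]
    exact Submodule.smul_mem _ _ (B_mem_Sp ((pairs_supp_rep_iff T _).mpr (Finset.mem_powersetCard.mp x.1.2).1))

/-- **`Hom(univ,k) ⊓ Sp(pairs ⊆ T) ≤ span{sub-box standard monomials} ⊔ (SI_k ⊓ Sp(pairs ⊆ T))`**: every monomial of the sub-box is standard modulo `SI_k` (gen 11), projected. -/
theorem Hom_inf_Sp_pairs_le_span_rep_sup (T : Finset (Fin N)) (k : ℕ) :
    Hom K (In N) (Finset.univ : Finset (In N)) k ⊓ Sp K (fun s : Finset (In N) => ∀ i ∈ s, pr i ∈ T)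
      ≤ Submodule.span K (Set.range fun x : ↥(T.powersetCard k) × Fin (k + 1) => rep K ((⟨⟨(x.1 : Finset (Fin N)), (Finset.mem_powersetCard.mp x.1.2).2⟩, x.2⟩ : RIdx N k)))
        ⊔ siegelIdeal K N k ⊓ Sp K (fun s : Finset (In N) => ∀ i ∈ s, pr i ∈ T) := by
  rw [Hom_univ_inf_Sp_pairs_eq, Hom_eq_Sp]
  change Submodule.span K ((fun s : Finset (In N) => B K (In N) s) '' {s | s ⊆ (Finset.univ.filter fun i : In N => pr i ∈ T) ∧ s.card = k}) ≤ _
  rw [Submodule.span_le]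
  rintro _ ⟨t, ⟨htT, htk⟩, rfl⟩
  have htT' : ∀ i ∈ t, pr i ∈ T := fun i hi => (Finset.mem_filter.mp (htT hi)).2
  have hmem := B_mem_repSpan_sup K t
  rw [htk, Submodule.mem_sup] at hmem
  obtain ⟨r, hr, s, hs, hrs⟩ := hmem
  have hproj : proj (K := K) (fun s : Finset (In N) => ∀ i ∈ s, pr i ∈ T) (B K (In N) t) = B K (In N) t :=
    proj_eq_self (fun s h => h) (B_mem_Sp (P := fun s : Finset (In N) => ∀ i ∈ s, pr i ∈ T) htT')
  show B K (In N) t ∈ _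
  rw [← hproj, ← hrs, map_add]
  exact Submodule.add_mem_sup (proj_pairs_mem_span_rep_sub K T hr) ⟨proj_pairs_mem_siegelIdeal K T hs, proj_mem _ s⟩

/-- the sub-box's standard monomials are linearly independent (a sub-family of gen 11's, independent under `sym`). -/
theorem linearIndependent_rep_sub (T : Finset (Fin N)) (k : ℕ) :
    LinearIndependent K fun x : ↥(T.powersetCard k) × Fin (k + 1) => rep K ((⟨⟨(x.1 : Finset (Fin N)), (Finset.mem_powersetCard.mp x.1.2).2⟩, x.2⟩ : RIdx N k)) := by
  have hinj : Function.Injective fun x : ↥(T.powersetCard k) × Fin (k + 1) => ((⟨⟨(x.1 : Finset (Fin N)), (Finset.mem_powersetCard.mp x.1.2).2⟩, x.2⟩ : RIdx N k)) := by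
    rintro ⟨⟨S, hS⟩, i⟩ ⟨⟨S', hS'⟩, i'⟩ h
    simp only [Prod.mk.injEq, Subtype.mk.injEq] at h
    obtain ⟨rfl, rfl⟩ := h
    rfl
  exact LinearIndependent.of_comp (sym K).toLinearMap ((linearIndependent_sym_rep K (n := N) k).comp _ hinj)

/-- `span{sub-box standard monomials} ⊓ SI_k = ⊥` (`sym` kills `SI_k` and is injective on the standard monomials). -/
theorem span_rep_sub_inf_siegelIdeal_eq_bot (T : Finset (Fin N)) (k : ℕ) :
    Submodule.span K (Set.range fun x : ↥(T.powersetCard k) × Fin (k + 1) => rep K ((⟨⟨(x.1 : Finset (Fin N)), (Finset.mem_powersetCard.mp x.1.2).2⟩, x.2⟩ : RIdx N k)))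
      ⊓ siegelIdeal K N k = ⊥ := by
  rw [Submodule.eq_bot_iff]
  rintro v ⟨hv, hvS⟩
  obtain ⟨c, rfl⟩ := (Submodule.mem_span_range_iff_exists_fun K).mp hv
  have h0 := sym_eq_zero_of_mem_siegelIdeal K hvS
  rw [map_sum] at h0
  simp_rw [map_smul] at h0
  have hinj : Function.Injective fun x : ↥(T.powersetCard k) × Fin (k + 1) => ((⟨⟨(x.1 : Finset (Fin N)), (Finset.mem_powersetCard.mp x.1.2).2⟩, x.2⟩ : RIdx N k)) := by
    rintro ⟨⟨S, hS⟩, i⟩ ⟨⟨S', hS'⟩, i'⟩ h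
    simp only [Prod.mk.injEq, Subtype.mk.injEq] at h
    obtain ⟨rfl, rfl⟩ := h
    rfl
  have hli := (linearIndependent_sym_rep K (n := N) k).comp _ hinj
  have hc : ∀ x, c x = 0 := fun x => Fintype.linearIndependent_iff.mp hli c h0 x
  simp [hc]

omit [Field K] in
/-- the number of sub-box standard monomials: `(k+1) · C(|T|, k)`. -/
theorem card_powersetCard_mul (T : Finset (Fin N)) (k : ℕ) : Fintype.card (↥(T.powersetCard k) × Fin (k + 1)) = (k + 1) * T.card.choose k := by
  rw [Fintype.card_prod, Fintype.card_coe, Finset.card_powersetCard, Fintype.card_fin, mul_comm]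

/-- **THE SIEGEL IDEAL OF A SUB-BOX: `dim (SI_k ⊓ Sp(pairs ⊆ T)) + (k+1)·C(|T|, k) = C(|T| + |T|, k)`** for every set `T` of pairs, every `k`, every field — gen 11's
`dim SI_k = C(2n,k) − (k+1)·C(n,k)` with `|T|` for `n`. -/
theorem finrank_siegelIdeal_inf_Sp_pairs_add (T : Finset (Fin N)) (k : ℕ) :
    finrank K ↥(siegelIdeal K N k ⊓ Sp K (fun s : Finset (In N) => ∀ i ∈ s, pr i ∈ T)) + (k + 1) * T.card.choose k = (T.card + T.card).choose k := by
  have hsup : Submodule.span K (Set.range fun x : ↥(T.powersetCard k) × Fin (k + 1) => rep K ((⟨⟨(x.1 : Finset (Fin N)), (Finset.mem_powersetCard.mp x.1.2).2⟩, x.2⟩ : RIdx N k)))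
      ⊔ siegelIdeal K N k ⊓ Sp K (fun s : Finset (In N) => ∀ i ∈ s, pr i ∈ T)
      = Hom K (In N) (Finset.univ : Finset (In N)) k ⊓ Sp K (fun s : Finset (In N) => ∀ i ∈ s, pr i ∈ T) :=
    le_antisymm (sup_le (span_rep_sub_le K T k) (inf_le_inf (by rw [← exteriorPower_eq_Hom_univ]; exact siegelIdeal_le_exteriorPower K k) le_rfl))
      (Hom_inf_Sp_pairs_le_span_rep_sup K T k)
  have hinf : Submodule.span K (Set.range fun x : ↥(T.powersetCard k) × Fin (k + 1) => rep K ((⟨⟨(x.1 : Finset (Fin N)), (Finset.mem_powersetCard.mp x.1.2).2⟩, x.2⟩ : RIdx N k)))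
      ⊓ (siegelIdeal K N k ⊓ Sp K (fun s : Finset (In N) => ∀ i ∈ s, pr i ∈ T)) = ⊥ :=
    le_bot_iff.mp (le_trans (inf_le_inf le_rfl inf_le_left) (le_of_eq (span_rep_sub_inf_siegelIdeal_eq_bot K T k)))
  have hR : finrank K ↥(Submodule.span K (Set.range fun x : ↥(T.powersetCard k) × Fin (k + 1) =>
      rep K ((⟨⟨(x.1 : Finset (Fin N)), (Finset.mem_powersetCard.mp x.1.2).2⟩, x.2⟩ : RIdx N k)))) = (k + 1) * T.card.choose k := by
    rw [finrank_span_eq_card (linearIndependent_rep_sub K T k), card_powersetCard_mul]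
  have hH : finrank K ↥(Hom K (In N) (Finset.univ : Finset (In N)) k ⊓ Sp K (fun s : Finset (In N) => ∀ i ∈ s, pr i ∈ T)) = (T.card + T.card).choose k := by
    rw [Hom_univ_inf_Sp_pairs_eq, finrank_Hom_In, card_letters_eq]
  have h := Submodule.finrank_sup_add_finrank_inf_eq
    (Submodule.span K (Set.range (fun x : ↥(T.powersetCard k) × Fin (k + 1) => rep K ((⟨⟨(x.1 : Finset (Fin N)), (Finset.mem_powersetCard.mp x.1.2).2⟩, x.2⟩ : RIdx N k)))))
    (siegelIdeal K N k ⊓ Sp K (fun s : Finset (In N) => ∀ i ∈ s, pr i ∈ T))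
  rw [hsup, hinf, finrank_bot, add_zero, hH, hR] at h
  omega

/-- subtraction form: **`dim (SI_k ⊓ Sp(pairs ⊆ T)) = C(2|T|, k) − (k+1)·C(|T|, k)`.** -/
theorem finrank_siegelIdeal_inf_Sp_pairs_eq (T : Finset (Fin N)) (k : ℕ) :
    finrank K ↥(siegelIdeal K N k ⊓ Sp K (fun s : Finset (In N) => ∀ i ∈ s, pr i ∈ T)) = (T.card + T.card).choose k - (k + 1) * T.card.choose k := by
  have h := finrank_siegelIdeal_inf_Sp_pairs_add K T k
  omega

/-! ## §396. The excess law on every sub-box -/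

/-- `SI_k ⊓ Sp(pairs ⊆ T) ≤ Kr(univ, w_N q, k) ⊓ Sp(pairs ⊆ T)`. -/
theorem siegelIdeal_inf_Sp_pairs_le_Kr (T : Finset (Fin N)) (q : ℕ → K) (k : ℕ) :
    siegelIdeal K N k ⊓ Sp K (fun s : Finset (In N) => ∀ i ∈ s, pr i ∈ T) ≤ Kr K (Finset.univ : Finset (In N)) (w K N N q) k ⊓ Sp K (fun s : Finset (In N) => ∀ i ∈ s, pr i ∈ T) :=
  inf_le_inf (fun _ hθ => mem_Kr.mpr ⟨by rw [← exteriorPower_eq_Hom_univ]; exact siegelIdeal_le_exteriorPower K k hθ, mul_w_eq_zero_of_mem_siegelIdeal K hθ q⟩) le_rfl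

/-- **THE EXCESS LAW ON EVERY SUB-BOX: `dim (Kr(univ, w_N q, k) ⊓ Sp(pairs ⊆ T)) + C(|T|,k)·rank H_k(q) = dim (SI_k ⊓ Sp(pairs ⊆ T)) + (k+1)·C(|T|,k)`** — the restricted
kernel exceeds the restricted Siegel ideal by `C(|T|,k)·(k + 1 − rank H_k(q))` (every `T`, `k`, `q`, field; `T = univ` is gen 11's excess law). -/
theorem finrank_Kr_w_inf_Sp_pairs_eq_siegelIdeal_add (T : Finset (Fin N)) (k : ℕ) (q : ℕ → K) :
    finrank K ↥(Kr K (Finset.univ : Finset (In N)) (w K N N q) k ⊓ Sp K (fun s : Finset (In N) => ∀ i ∈ s, pr i ∈ T)) + T.card.choose k * (hankel1 K N k q).rank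
      = finrank K ↥(siegelIdeal K N k ⊓ Sp K (fun s : Finset (In N) => ∀ i ∈ s, pr i ∈ T)) + (k + 1) * T.card.choose k := by
  rw [finrank_Kr_w_inf_Sp_pairs_add, finrank_siegelIdeal_inf_Sp_pairs_add]

/-- **the restricted kernel IS the restricted Siegel ideal iff `|T| < k` (no `k`-sets of pairs inside `T`) or `rank H_k(q) = k + 1` (the generic rank).** -/
theorem Kr_w_inf_Sp_pairs_eq_siegelIdeal_inf_iff (T : Finset (Fin N)) (k : ℕ) (q : ℕ → K) :
    Kr K (Finset.univ : Finset (In N)) (w K N N q) k ⊓ Sp K (fun s : Finset (In N) => ∀ i ∈ s, pr i ∈ T) = siegelIdeal K N k ⊓ Sp K (fun s : Finset (In N) => ∀ i ∈ s, pr i ∈ T)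
      ↔ T.card < k ∨ (hankel1 K N k q).rank = k + 1 := by
  have h := finrank_Kr_w_inf_Sp_pairs_eq_siegelIdeal_add K T k q
  have hle := siegelIdeal_inf_Sp_pairs_le_Kr K T q k
  have hrk : (hankel1 K N k q).rank ≤ k + 1 := le_trans (Matrix.rank_le_card_height _) (by rw [Fintype.card_fin])
  constructor
  · intro he
    rw [he] at h
    by_cases hT : T.card < k
    · exact Or.inl hT
    · right
      have hpos : 0 < T.card.choose k := Nat.choose_pos (not_lt.mp hT)
      have h2 : T.card.choose k * (hankel1 K N k q).rank = T.card.choose k * (k + 1) := by rw [mul_comm (T.card.choose k) (k + 1)]; omega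
      exact Nat.eq_of_mul_eq_mul_left hpos h2
  · rintro (hT | hr)
    · refine (Submodule.eq_of_le_of_finrank_eq hle ?_).symm
      rw [Nat.choose_eq_zero_of_lt hT, zero_mul, mul_zero, add_zero, add_zero] at h
      exact h.symm
    · refine (Submodule.eq_of_le_of_finrank_eq hle ?_).symm
      rw [hr, mul_comm] at h
      omega

end Summit.Ventures.HSemireg.Wedge.HankelOuter
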